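/-
Origin: expansion seat `planner-pub-hodgecm-toy2-g4-0`, handover #4 2026-08-18T07:59:00Z (`HOME/pub-hodgecm-toy2-g4/lean/Toy2g4/PadH6Qw8.lean`, md5 c56da1ce, 230 lines);
landed by the gen-7 packager in gate run 26 as `HodgeCM/Model/Toy/ToyPadH6Qw8.lean` (import ^import Toy2g4\.PadH6Alg\b→import HodgeCM.Model.Toy.ToyPadH6Alg ×1).
-/
/-
Copyright: HODGE-CM cell, CONSISTENCY seat 2 (6a)(ii), generation 4 (unit pub-hodgecm-toy2-g4).  RUN 26.
Package target: `HodgeCM/Model/Toy/ToyPadH6Qw8.lean` (additive leaf; lands after `HodgeCM/Model/Toy/ToyPadH6Alg.lean`).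
-/
import Summits.HodgeConjecture.HodgeCM.Model.Toy.ToyPadH6Alg_2

/-!
# `qw8_sufficiency` FAILS in the padded universe `U♯` — the truth table of `padModel` completed

`HodgeCM.Model.PadH6` left one entry of the profile of `padModel = toyModel♯` undecided: the open input
`Qw8Sufficiency` ([QW8] Lemma 8 as a sufficiency statement: a weight vector of a HODGE weight whose Lefschetz character
is an integral combination of face characters is algebraic).  It is **false in `U♯`** whenever `U` is a model of
`ModelAxioms ∧ N1 ∧ W_RK4`:

* take the Galois CM field `F` of degree `≥ 6` and the CM type `Φ` provided by `faceHypothesesInhabited`, any embedding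
  `φ₀`, and on `A′ = A_Φ³ × A_Φ̄³` (`Θ = (Φ, Φ, Φ, Φ̄, Φ̄, Φ̄)`) the weight `S = ({φ₀}, …, {φ₀})`;
* `S` IS a Hodge weight (`isHodgeWeight_S`: on every Galois translate `3·1_Φ + 3·1_Φ̄ = 3`) and its Lefschetz character
  VANISHES (`lefChar_S`: `3·ā[Ψ] + 3·ā[Ψ̄] = 0` in `Asym F`, by `pullType_bar` / `achar_bar`) — so the character
  hypothesis of `Qw8Sufficiency` holds with the empty combination of faces;
* the weight LINE `V_S ⊂ H⁶(A′, ℂ)` (`finrank_weightSpace`, from `ModelAxioms` + N1) is nonzero, and for `0 ≠ w ∈ V_S` the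
  PAD vector `(0, w) ∈ H♯⁶(A′, ℂ) = H⁶ ⊕ H⁶` is a weight vector of `U♯` of weight `S` (`isWeightVector_ofPadC`: the CM
  action on the pad is the diagonal one);
* but `Alg♯³ ⊗ ℂ = (Alg³ ⊕ 0) ⊗ ℂ` contains no nonzero pad vector (`PadSix.snd_baseChange_eq_zero_of_mem_prod_bot`).

Hence `PadH6.not_qw8Sufficiency : U.ModelAxioms → U.Fact_cupExterior → U.W_RK4 → ¬ U♯.Qw8Sufficiency`, and for the toy:
`Toy.not_padModel_qw8Sufficiency`, the completed profile `Toy.padModel_profile'`, and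
`Toy.qw8Sufficiency_independent'` — `Qw8Sufficiency` holds in `toyModel` and in `padAlgModel`, fails in `padModel`
(and in g3's `truncModel`), all four being models of `ModelAxioms ∧ N2 ∧ N3 ∧ N4 ∧ F5 ∧ Fact_dimProd ∧ W_RK4`; unlike
`truncModel`, `padModel` keeps F4 `Fact_cupAlg`, so `qw8_sufficiency` is independent of
`ModelAxioms ∧ N2 ∧ N3 ∧ N4 ∧ F4 ∧ F5 ∧ Fact_dimProd ∧ W_RK4` as well.

Axioms: `propext`, `Classical.choice`, `Quot.sound` only.
-/

open scoped TensorProduct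

namespace HodgeCM

open Literature.AlgebraicGeometry.Motives (CMType HodgeStructure)
open Literature.AlgebraicGeometry.Motives.HodgeStructure (ofRat)

namespace PadSix

variable {A B : Type} [AddCommGroup A] [AddCommGroup B] [Module ℚ A] [Module ℚ B]

/-- `(S ⊕ 0) ⊗ ℂ` has zero second component. -/
theorem snd_baseChange_eq_zero_of_mem_prod_bot (S : Submodule ℚ A) {z : ℂ ⊗[ℚ] (A × B)}
    (hz : z ∈ (S.prod (⊥ : Submodule ℚ B)).baseChange ℂ) : (LinearMap.snd ℚ A B).baseChange ℂ z = 0 := by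
  have h1 : (S.prod (⊥ : Submodule ℚ B)).baseChange ℂ ≤ LinearMap.ker ((LinearMap.snd ℚ A B).baseChange ℂ) := by
    rw [Submodule.baseChange_eq_span, Submodule.span_le]
    rintro _ ⟨m, hm, rfl⟩
    rw [SetLike.mem_coe, LinearMap.mem_ker, TensorProduct.mk_apply, LinearMap.baseChange_tmul, LinearMap.snd_apply,
      (Submodule.mem_bot ℚ).mp (Submodule.mem_prod.mp hm).2, TensorProduct.tmul_zero]
  exact LinearMap.mem_ker.mp (h1 hz)

end PadSix

namespace Universe

variable {U : Universe}

namespace PadH6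

/-! ## 1. Pad vectors, complexified -/

/-- the complexified pad inclusion `H⁶(X, ℂ) → H♯⁶(X, ℂ)`, `w ↦ (0, w)` -/
noncomputable def ofPadC (X : U.Var) : U.CohC X 6 →ₗ[ℂ] U.padH6.CohC X 6 := (ofPad X 6).baseChange ℂ

/-- (Ported verbatim from the HodgeCMPerL package; no docstring in the source.) -/
theorem padOf_ofPad_six (X : U.Var) (v : U.Coh X 6) : padOf X 6 (ofPad X 6 v) = v := rfl

/-- (Ported verbatim from the HodgeCMPerL package; no docstring in the source.) -/
theorem padOfC_ofPadC (X : U.Var) (w : U.CohC X 6) : padOfC X 6 (ofPadC X w) = w := by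
  have h : padOf X 6 ∘ₗ ofPad X 6 = LinearMap.id := LinearMap.ext (padOf_ofPad_six X)
  have h' := congrArg (fun g : U.Coh X 6 →ₗ[ℚ] U.Coh X 6 => g.baseChange ℂ w) h
  simp only [LinearMap.baseChange_comp, LinearMap.comp_apply, LinearMap.baseChange_id, LinearMap.id_apply] at h'
  exact h'

/-- (Ported verbatim from the HodgeCMPerL package; no docstring in the source.) -/
theorem pull_ofPad {X Y : U.Var} (f : U.Mor X Y) (v : U.Coh Y 6) :
    U.padH6.pull f 6 (ofPad Y 6 v) = ofPad X 6 (U.pull f 6 v) := by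
  show (U.pull f 6 0, U.pull f 6 v) = ((0 : U.Coh X 6), U.pull f 6 v)
  rw [map_zero]

/-- (Ported verbatim from the HodgeCMPerL package; no docstring in the source.) -/
theorem pull_comp_ofPad {X Y : U.Var} (f : U.Mor X Y) : U.padH6.pull f 6 ∘ₗ ofPad Y 6 = ofPad X 6 ∘ₗ U.pull f 6 :=
  LinearMap.ext (pull_ofPad f)

/-- (Ported verbatim from the HodgeCMPerL package; no docstring in the source.) -/
theorem pullC_ofPadC {X Y : U.Var} (f : U.Mor X Y) (w : U.CohC Y 6) :
    U.padH6.pullC f 6 (ofPadC Y w) = ofPadC X (U.pullC f 6 w) := by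
  have h := congrArg (fun g : U.Coh Y 6 →ₗ[ℚ] U.padH6.Coh X 6 => g.baseChange ℂ w) (pull_comp_ofPad f)
  simp only [LinearMap.baseChange_comp, LinearMap.comp_apply] at h
  exact h

/-- A nonzero pad vector is never in `Alg♯³ ⊗ ℂ = (Alg³ ⊕ 0) ⊗ ℂ`. -/
theorem ofPadC_mem_algC_iff (X : U.Var) (w : U.CohC X 6) :
    ofPadC X w ∈ U.padH6.algC X 3 ↔ w = 0 := by
  constructor
  · intro h
    have h' : ofPadC X w ∈ ((U.alg X 3).prod (⊥ : Submodule ℚ (U.Coh X 6))).baseChange ℂ := h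
    rw [← padOfC_ofPadC X w]
    exact PadSix.snd_baseChange_eq_zero_of_mem_prod_bot (U.alg X 3) h'
  · rintro rfl
    rw [map_zero]
    exact Submodule.zero_mem _

section Weights

variable {F : CMField} {n : ℕ} (Θ : Fin (n + 1) → CMType F)

set_option smartUnfolding false in
/-- **Pad vectors of weight vectors are weight vectors of `U♯`** (the CM action on the pad is the diagonal one). -/
theorem isWeightVector_ofPadC {S : Fin (n + 1) → Finset ((F : Type) →+* ℂ)} {w : U.CohC (U.cmProd F Θ) 6}
    (hw : U.IsWeightVector F Θ S 6 w) : U.padH6.IsWeightVector F Θ S 6 (ofPadC (U := U) (U.cmProd F Θ) w) := by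
  intro j a M hM
  have h := hw j a M ((isFactorAct_iff Θ j a M).mp hM)
  exact (pullC_ofPadC (U := U) (X := U.cmProd F Θ) (Y := U.cmProd F Θ) M w).trans
    ((congrArg (ofPadC (U := U) (U.cmProd F Θ)) h).trans (map_smul _ _ _))

end Weights

/-! ## 2. A Hodge weight with vanishing Lefschetz character -/

section HodgeWeight

variable {F : CMField} (Φ : CMType F) (φ₀ : (F : Type) →+* ℂ)

/-- `Θ = (Φ, Φ, Φ, Φ̄, Φ̄, Φ̄)` -/
def thetaS : Fin (5 + 1) → CMType F := ![Φ, Φ, Φ, CMTypeOps.bar Φ, CMTypeOps.bar Φ, CMTypeOps.bar Φ]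

/-- `S = ({φ₀}, …, {φ₀})` -/
def weightS : Fin (5 + 1) → Finset ((F : Type) →+* ℂ) := fun _ => {φ₀}

/-- (Ported verbatim from the HodgeCMPerL package; no docstring in the source.) -/
theorem sum_card_weightS : (∑ j, (weightS φ₀ j).card) = 6 := by
  simp [weightS]

/-- `S` is a Hodge weight on `A_Φ³ × A_Φ̄³`: every Galois translate of `e_S` has type `(3,3)`. -/
theorem isHodgeWeight_S : IsHodgeWeight (thetaS Φ) 3 (weightS φ₀) := by
  refine ⟨sum_card_weightS φ₀, fun P => ?_⟩
  simp only [weightS, Finset.sum_singleton, Fin.sum_univ_succ, Fin.sum_univ_zero, thetaS, Matrix.cons_val_zero,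
    Matrix.cons_val_succ, ind_bar]
  ring

/-- … and its Lefschetz character vanishes: `a(e_S) = 3 ā[Ψ] + 3 ā[Ψ̄] = 0`. -/
theorem lefChar_S : lefChar (thetaS Φ) (weightS φ₀) = 0 := by
  simp only [lefChar, weightS, Finset.sum_singleton, Fin.sum_univ_succ, Fin.sum_univ_zero, thetaS,
    Matrix.cons_val_zero, Matrix.cons_val_succ, pullType_bar, achar_bar]
  abel

/-- so the character hypothesis of `Qw8Sufficiency` holds with NO faces at all. -/
theorem lefChar_S_decomposable :
    ∃ (σ₀ : (F : Type) →+* ℂ) (m : ℕ) (f : Fin m → Face F) (c : Fin m → ℤ),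
      lefChar (thetaS Φ) (weightS φ₀) = ∑ i, c i • lefChar (f i).corner (fun _ => {σ₀}) :=
  ⟨φ₀, 0, Fin.elim0, Fin.elim0, by rw [lefChar_S, Finset.univ_eq_empty, Finset.sum_empty]⟩

end HodgeWeight

/-! ## 3. `¬ Qw8Sufficiency` in `U♯` -/

set_option smartUnfolding false in
/-- **[QW8] Lemma-8 sufficiency FAILS in `U♯`**: the pad vector `(0, w)` of a nonzero vector `w` of the weight line
`V_S ⊂ H⁶(A_Φ³ × A_Φ̄³, ℂ)` is a weight vector of the Hodge weight `S`, whose Lefschetz character is `0`, and it is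
not in `Alg♯³ ⊗ ℂ`.  (Hypotheses: the weight line needs `ModelAxioms` + N1; the face hypothesis of `Qw8Sufficiency`
in `U♯` is `W_RK4` of `U`.) -/
theorem not_qw8Sufficiency (M : U.ModelAxioms) (hN1 : U.Fact_cupExterior) (hW : U.W_RK4) :
    ¬ U.padH6.Qw8Sufficiency := by
  intro hQ
  obtain ⟨F, hG, h6, f, φ₀, -⟩ := faceHypothesesInhabited
  have hfaces : ∀ g : Face F, U.padH6.WeilFaceAlgebraic F g := (w_RK4_iff (U := U)).mpr hW F hG h6
  -- the weight line of `S` in degree six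
  have hline : Module.finrank ℂ (U.weightSpace F (thetaS f.Φ) (weightS φ₀) 6) = 1 := by
    rw [finrank_weightSpace M hN1 (by norm_num) (weightS φ₀), if_pos (sum_card_weightS φ₀)]
  have hpos : 0 < Module.finrank ℂ (U.weightSpace F (thetaS f.Φ) (weightS φ₀) 6) := by rw [hline]; exact Nat.one_pos
  obtain ⟨w, hw⟩ := Module.finrank_pos_iff_exists_ne_zero.mp hpos
  -- its pad vector is an `S`-weight vector of `U♯` with decomposable (zero) character, hence algebraic by `hQ` …
  have hx : U.padH6.IsWeightVector F (thetaS f.Φ) (weightS φ₀) (2 * 3)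
      (ofPadC (U := U) (U.cmProd F (thetaS f.Φ)) (w : U.CohC (U.cmProd F (thetaS f.Φ)) 6)) :=
    isWeightVector_ofPadC (U := U) (thetaS f.Φ) w.2
  have hmem := hQ F hG h6 hfaces 5 (thetaS f.Φ) 3 (weightS φ₀) _ (isHodgeWeight_S f.Φ φ₀) hx
    (lefChar_S_decomposable f.Φ φ₀)
  -- … i.e. `w = 0`
  exact hw (Subtype.ext ((ofPadC_mem_algC_iff (U := U) _ _).mp hmem))

/-- `OpenInputs` fails in `U♯` also through its field `qw8_sufficiency`. -/
theorem not_openInputs' (M : U.ModelAxioms) (hN1 : U.Fact_cupExterior) (hW : U.W_RK4) : ¬ U.padH6.OpenInputs :=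
  fun h => not_qw8Sufficiency M hN1 hW h.qw8_sufficiency

end PadH6

end Universe

/-! ## 4. The toy instance: `padModel`'s profile completed -/

namespace Toy

open Universe

/-- (Ported verbatim from the HodgeCMPerL package; no docstring in the source.) -/
theorem not_padModel_qw8Sufficiency : ¬ padModel.Qw8Sufficiency :=
  PadH6.not_qw8Sufficiency toyModel_modelAxioms toyModel_fact_cupExterior toyModel_w_rk4

/-- **The completed truth table of `padModel`**: TRUE — `ModelAxioms`, N2, N3, N4, `Fact_dimProd`, F5, F4, `W_RK4`;
FALSE — N1, `PohlmannSpan`, `Qw8Sufficiency`, `HC_CM`, `OpenInputs`. -/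
theorem padModel_profile' :
    (padModel.ModelAxioms ∧ padModel.Fact_cup_hodge ∧ padModel.Fact_pull_H0 ∧ padModel.Fact_hodge_F0 ∧
        padModel.Fact_dimProd ∧ padModel.Fact_cupAssoc ∧ padModel.Fact_cupAlg ∧ padModel.W_RK4) ∧
      (¬ padModel.Fact_cupExterior ∧ ¬ padModel.PohlmannSpan ∧ ¬ padModel.Qw8Sufficiency ∧ ¬ padModel.HC_CM ∧
        ¬ padModel.OpenInputs) :=
  ⟨padModel_profile.1,
    ⟨not_padModel_fact_cupExterior, not_padModel_pohlmannSpan, not_padModel_qw8Sufficiency, not_padModel_hc_cm,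
      not_padModel_openInputs⟩⟩

/-- **`Qw8Sufficiency` is independent of `ModelAxioms ∧ N2 ∧ N3 ∧ N4 ∧ F4 ∧ F5 ∧ Fact_dimProd ∧ W_RK4`**: it holds in
`padAlgModel` (and in `toyModel`) and fails in `padModel`; the two padded models differ ONLY in which degree-six classes
are declared algebraic. -/
theorem qw8Sufficiency_independent' :
    ∃ U₁ U₂ : Universe,
      (U₁.ModelAxioms ∧ U₁.Fact_cup_hodge ∧ U₁.Fact_pull_H0 ∧ U₁.Fact_hodge_F0 ∧ U₁.Fact_cupAlg ∧ U₁.Fact_cupAssoc ∧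
          U₁.Fact_dimProd ∧ U₁.W_RK4) ∧
        (U₂.ModelAxioms ∧ U₂.Fact_cup_hodge ∧ U₂.Fact_pull_H0 ∧ U₂.Fact_hodge_F0 ∧ U₂.Fact_cupAlg ∧ U₂.Fact_cupAssoc ∧
          U₂.Fact_dimProd ∧ U₂.W_RK4) ∧
        U₁.Qw8Sufficiency ∧ ¬ U₂.Qw8Sufficiency :=
  ⟨padAlgModel, padModel,
    ⟨padAlgModel_modelAxioms, padAlgModel_fact_cup_hodge, padAlgModel_fact_pull_H0, padAlgModel_fact_hodge_F0,
      padAlgModel_fact_cupAlg, padAlgModel_fact_cupAssoc, padAlgModel_fact_dimProd, padAlgModel_w_rk4⟩,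
    ⟨padModel_modelAxioms, padModel_fact_cup_hodge, padModel_fact_pull_H0, padModel_fact_hodge_F0, padModel_fact_cupAlg,
      padModel_fact_cupAssoc, padModel_fact_dimProd, padModel_w_rk4⟩,
    padAlgModel_qw8Sufficiency, not_padModel_qw8Sufficiency⟩

/-- In particular neither padded model satisfies `OpenInputs`, for two different named reasons. -/
theorem not_padModel_openInputs' : ¬ padModel.OpenInputs := fun I => not_padModel_qw8Sufficiency I.qw8_sufficiency

end Toy

end HodgeCM
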